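import Summits.RiemannHypothesis.RiemannHypothesis.Theorems.GroundBartaEvenWinsBeyondArchDeflationIncrements
import Mathlib.MeasureTheory.Group.Prod
import HarnessLib

/-!
# RiemannHypothesis / GroundBarta — rung 4 (`EvenWinsBeyondArch`, stmt-RiemannHypothesis-18807):
# the deflated Temple (Lehmann–Maehly) L-side programme, V — the window image of a trial vector

Helper file (`--supports stmt-RiemannHypothesis-18807`), RH-free, Mathlib + landed tree files only, no
definitions, no named facts.

The deflated Temple bound (`Theorems/GroundBartaEvenWinsBeyondArchDeflationBound`) asks, for each explicit trial
vector `v` (e.g. polynomial × indicator of the window), for a WINDOW IMAGE `F ∈ L²` representing the closed form,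
`P(v, f) + 𝓔_c(v, f) − M_c ∫Re(v f̄) = ∫ Re(F f̄)` for every window function `f` (hypothesis `hrepr`).  This file
discharges that hypothesis once and for all by the EXPLICIT FORMULA (Bombieri's Euler–Lagrange operator of the
Markov-decomposed form, [Bombieri 2000, §4 Lemma 1 eq. (4.2)] read through increments)

  `F(y) = 𝟙_{[-c,c]}(y) · [ 2(∫v ch) ch(y/2) − 2(∫v sh) sh(y/2)
            + Σ_{log n < 2c} Λ(n) n^{-1/2} (2v(y) − v(y − log n) − v(y + log n))
            + ∫₀^∞ ρ(t) (2v(y) − v(y − t) − v(y + t)) dt ]  −  M_c v(y)`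

(`ch = cosh(·/2)`, `sh = sinh(·/2)`, `ρ = weilArchDensity`), valid for every `v ∈ L²` vanishing off `[-c, c]`
whose archimedean second differences are absolutely integrable inside the window with a square-integrable
majorant `m`: `∫₀^∞ ρ(t)|2v(y) − v(y−t) − v(y+t)| dt ≤ m(y)` for `y ∈ (-c, c)`:

* `dt_weilIncrement₂_eq_secondDiff` — `D_t(v, f) = ∫ Re[(2v(y) − v(y−t) − v(y+t)) f̄(y)] dy`;
* `dt_aesm_secondDiff*` — joint / sliced measurability of the second differences;
* `dt_windowImage_memLp` — `F ∈ L²`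
  (the representation identity itself is in the sibling `…DeflationWindowImageRepr.lean`).

So the certificate side of the programme is left with FINITE data only: the majorant `m` for its trial vectors,
the low-precision `β`-certificate, and enclosures of the explicit integrals `A`, `G`, `∫ F_i F_j`.
Prover B, speedrun unit `sr-gb-rung-b` (gen 3).

References: E. Bombieri, Rend. Mat. Acc. Lincei (9) 11 (2000) 183–233, Thm 2 and §4 Lemma 1; A. Weinstein,
W. Stenger, *Methods of Intermediate Problems for Eigenvalues* (1972) Ch. 5 §9.
-/

set_option linter.dupNamespace false

noncomputable section

open MeasureTheory Set Filter
open scoped Topology ENNReal NNReal ComplexConjugate BigOperators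

namespace Summit.RiemannHypothesis.RiemannHypothesis.Theorems.EvenWinsBeyondArch

open Literature.NumberTheory.LFunctions Literature.NumberTheory.LFunctions.ConnesVanSuijlekom
open Summit.RiemannHypothesis.RiemannHypothesis.Theorems.OddSector
  (weilIncrement₂ weilDirichletEnergy₂ weilPoleForm₂)

variable {c : ℝ} {v f : ℝ → ℂ}

/-! ## The polarised increment through second differences -/

/-- Translates of `L²` functions are in `L²`. -/
theorem dt_memLp_shift (hv : MemLp v 2) (s : ℝ) : MemLp (fun x ↦ v (x + s)) 2 :=
  hv.comp_measurePreserving (measurePreserving_add_right volume s)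

/-- `y ↦ v (y - s)` is in `L²`. -/
theorem dt_memLp_shift_sub (hv : MemLp v 2) (s : ℝ) : MemLp (fun x ↦ v (x - s)) 2 := by
  simpa only [sub_eq_add_neg] using dt_memLp_shift hv (-s)

/-- The second difference `2v − v(· − t) − v(· + t)` of an `L²` function is in `L²`. -/
theorem dt_memLp_secondDiff (hv : MemLp v 2) (t : ℝ) :
    MemLp (fun y ↦ 2 * v y - v (y - t) - v (y + t)) 2 := by
  have h2 : MemLp (fun y ↦ (2 : ℂ) * v y) 2 := hv.const_mul 2
  exact (h2.sub (dt_memLp_shift_sub hv t)).sub (dt_memLp_shift hv t)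

/-- **The polarised increment through second differences**: for `v, f ∈ L²`,
`D_t(v, f) = ∫ Re[(2v(y) − v(y − t) − v(y + t)) f̄(y)] dy`. -/
theorem dt_weilIncrement₂_eq_secondDiff (hv : MemLp v 2) (hf : MemLp f 2) (t : ℝ) :
    weilIncrement₂ v f t = ∫ y, ((2 * v y - v (y - t) - v (y + t)) * conj (f y)).re := by
  have i1 : Integrable fun x ↦ ((v (x + t) - v x) * conj (f (x + t))).re :=
    dt_integrable_mul_conj_re (dt_memLp_field hv t) (dt_memLp_shift hf t)
  have i2 : Integrable fun x ↦ ((v (x + t) - v x) * conj (f x)).re :=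
    dt_integrable_mul_conj_re (dt_memLp_field hv t) hf
  have i3 : Integrable fun y ↦ ((v y - v (y - t)) * conj (f y)).re :=
    dt_integrable_mul_conj_re (hv.sub (dt_memLp_shift_sub hv t)) hf
  have e1 : weilIncrement₂ v f t =
      (∫ x, ((v (x + t) - v x) * conj (f (x + t))).re) - ∫ x, ((v (x + t) - v x) * conj (f x)).re := by
    unfold weilIncrement₂
    rw [← integral_sub i1 i2]
    congr 1 with x
    rw [map_sub, mul_sub, Complex.sub_re]
  have e2 : ∫ x, ((v (x + t) - v x) * conj (f (x + t))).re = ∫ y, ((v y - v (y - t)) * conj (f y)).re := by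
    have := integral_add_right_eq_self (μ := volume) (fun y ↦ ((v y - v (y - t)) * conj (f y)).re) t
    simp only [add_sub_cancel_right] at this
    exact this
  rw [e1, e2, ← integral_sub i3 i2]
  congr 1 with y
  rw [← Complex.sub_re, ← sub_mul]
  ring_nf

/-! ## Joint measurability of the archimedean layer -/

/-- `(y, t) ↦ 2v(y) − v(y − t) − v(y + t)` is jointly a.e.-strongly measurable. -/
theorem dt_aesm_secondDiff (hv : AEStronglyMeasurable v volume) :
    AEStronglyMeasurable (fun p : ℝ × ℝ ↦ 2 * v p.1 - v (p.1 - p.2) - v (p.1 + p.2))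
      ((volume : Measure ℝ).prod (volume : Measure ℝ)) := by
  have h1 : AEStronglyMeasurable (fun p : ℝ × ℝ ↦ v p.1) ((volume : Measure ℝ).prod volume) := hv.comp_fst
  have h2 : AEStronglyMeasurable (fun p : ℝ × ℝ ↦ v (p.1 - p.2)) ((volume : Measure ℝ).prod volume) :=
    hv.comp_quasiMeasurePreserving (quasiMeasurePreserving_sub volume volume)
  have h3 : AEStronglyMeasurable (fun p : ℝ × ℝ ↦ v (p.1 + p.2)) ((volume : Measure ℝ).prod volume) :=
    hv.comp_quasiMeasurePreserving (quasiMeasurePreserving_add volume volume)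
  exact ((h1.const_mul 2).sub h2).sub h3

/-- The same on `ℝ × (0, ∞)`. -/
theorem dt_aesm_secondDiff_restrict (hv : AEStronglyMeasurable v volume) :
    AEStronglyMeasurable (fun p : ℝ × ℝ ↦ 2 * v p.1 - v (p.1 - p.2) - v (p.1 + p.2))
      ((volume : Measure ℝ).prod ((volume : Measure ℝ).restrict (Ioi 0))) := by
  have e : (volume : Measure ℝ).prod ((volume : Measure ℝ).restrict (Ioi 0)) =
      ((volume : Measure ℝ).prod (volume : Measure ℝ)).restrict (univ ×ˢ Ioi 0) := by
    rw [← Measure.prod_restrict, Measure.restrict_univ]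
  rw [e]
  exact (dt_aesm_secondDiff hv).restrict

/-- For fixed `y`, `t ↦ 2v(y) − v(y − t) − v(y + t)` is a.e.-strongly measurable. -/
theorem dt_aesm_secondDiff_slice (hv : AEStronglyMeasurable v volume) (y : ℝ) :
    AEStronglyMeasurable (fun t : ℝ ↦ 2 * v y - v (y - t) - v (y + t)) volume := by
  have h2 : AEStronglyMeasurable (fun t : ℝ ↦ v (y - t)) volume :=
    hv.comp_measurePreserving (Measure.measurePreserving_sub_left volume y)
  have h3 : AEStronglyMeasurable (fun t : ℝ ↦ v (y + t)) volume :=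
    hv.comp_measurePreserving (measurePreserving_add_left volume y)
  exact (aestronglyMeasurable_const.sub h2).sub h3

/-! ## The window image is square integrable -/

/-- **The archimedean layer of the window image is in `L²`**: under the majorant hypothesis,
`𝟙_{[-c,c]} · ∫₀^∞ ρ(t)(2v − v(·−t) − v(·+t)) dt ∈ L²`. -/
theorem dt_memLp_archLayer (hv : MemLp v 2) {m : ℝ → ℝ} (hm : MemLp m 2)
    (hHm : ∀ y ∈ Ioo (-c) c,
      ∫ t in Ioi 0, weilArchDensity t * ‖2 * v y - v (y - t) - v (y + t)‖ ≤ m y) :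
    MemLp (fun y ↦ (Icc (-c) c).indicator
      (fun y ↦ ∫ t in Ioi 0, (weilArchDensity t : ℂ) * (2 * v y - v (y - t) - v (y + t))) y) 2 := by
  have hmeas : AEStronglyMeasurable
      (fun y ↦ ∫ t in Ioi 0, (weilArchDensity t : ℂ) * (2 * v y - v (y - t) - v (y + t))) volume := by
    have hρ : AEStronglyMeasurable (fun p : ℝ × ℝ ↦ (weilArchDensity p.2 : ℂ))
        ((volume : Measure ℝ).prod ((volume : Measure ℝ).restrict (Ioi 0))) :=
      (Complex.continuous_ofReal.measurable.comp measurable_weilArchDensity).aestronglyMeasurable.comp_snd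
    exact (hρ.mul (dt_aesm_secondDiff_restrict hv.1)).integral_prod_right'
  have h1 : MemLp ((Icc (-c) c).indicator fun y ↦ ‖m y‖) 2 volume := hm.norm.indicator measurableSet_Icc
  have h2 : AEStronglyMeasurable ((Icc (-c) c).indicator fun y ↦
      ∫ t in Ioi 0, (weilArchDensity t : ℂ) * (2 * v y - v (y - t) - v (y + t))) volume :=
    hmeas.indicator measurableSet_Icc
  refine MemLp.of_le h1 h2 ?_
  have hc1 : ∀ᵐ y : ℝ, y ∉ ({-c, c} : Set ℝ) :=
    measure_eq_zero_iff_ae_notMem.1 ((Set.toFinite ({-c, c} : Set ℝ)).measure_zero volume)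
  filter_upwards [hc1] with y hy
  by_cases hyI : y ∈ Icc (-c) c
  · have hyo : y ∈ Ioo (-c) c := by
      simp only [mem_insert_iff, mem_singleton_iff, not_or] at hy
      exact ⟨lt_of_le_of_ne hyI.1 (Ne.symm hy.1), lt_of_le_of_ne hyI.2 hy.2⟩
    rw [indicator_of_mem hyI, indicator_of_mem hyI, Real.norm_eq_abs, abs_norm]
    calc ‖∫ t in Ioi 0, (weilArchDensity t : ℂ) * (2 * v y - v (y - t) - v (y + t))‖
        ≤ ∫ t in Ioi 0, ‖(weilArchDensity t : ℂ) * (2 * v y - v (y - t) - v (y + t))‖ :=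
          norm_integral_le_integral_norm _
      _ = ∫ t in Ioi 0, weilArchDensity t * ‖2 * v y - v (y - t) - v (y + t)‖ := by
          refine setIntegral_congr_fun measurableSet_Ioi fun t ht ↦ ?_
          rw [norm_mul, Complex.norm_real, Real.norm_of_nonneg (weilArchDensity_pos ht).le]
      _ ≤ m y := hHm y hyo
      _ ≤ ‖m y‖ := le_abs_self _
  · simp [indicator_of_notMem hyI]

/-- **The window image is in `L²`.** -/
theorem dt_windowImage_memLp {F : ℝ → ℂ} (hv : MemLp v 2) {m : ℝ → ℝ} (hm : MemLp m 2)
    (hHm : ∀ y ∈ Ioo (-c) c,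
      ∫ t in Ioi 0, weilArchDensity t * ‖2 * v y - v (y - t) - v (y + t)‖ ≤ m y)
    (hF : ∀ y, F y = (Icc (-c) c).indicator (fun y ↦
        2 * (∫ x, v x * (Real.cosh (x / 2) : ℂ)) * (Real.cosh (y / 2) : ℂ) -
          2 * (∫ x, v x * (Real.sinh (x / 2) : ℂ)) * (Real.sinh (y / 2) : ℂ) +
        (∑ n ∈ weilPrimeIndex c, (((ArithmeticFunction.vonMangoldt n : ℝ) / Real.sqrt n : ℝ) : ℂ) *
          (2 * v y - v (y - Real.log n) - v (y + Real.log n))) +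
        ∫ t in Ioi 0, (weilArchDensity t : ℂ) * (2 * v y - v (y - t) - v (y + t))) y -
      (weilMarkovConstant c : ℂ) * v y) :
    MemLp F 2 := by
  have eF : F = (Icc (-c) c).indicator (fun y ↦
        2 * (∫ x, v x * (Real.cosh (x / 2) : ℂ)) * (Real.cosh (y / 2) : ℂ) -
          2 * (∫ x, v x * (Real.sinh (x / 2) : ℂ)) * (Real.sinh (y / 2) : ℂ)) +
      ((Icc (-c) c).indicator (fun y ↦
        ∑ n ∈ weilPrimeIndex c, (((ArithmeticFunction.vonMangoldt n : ℝ) / Real.sqrt n : ℝ) : ℂ) *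
          (2 * v y - v (y - Real.log n) - v (y + Real.log n))) +
      ((Icc (-c) c).indicator (fun y ↦
        ∫ t in Ioi 0, (weilArchDensity t : ℂ) * (2 * v y - v (y - t) - v (y + t))) -
      fun y ↦ (weilMarkovConstant c : ℂ) * v y)) := by
    funext y
    rw [hF y]
    simp only [Pi.add_apply, Pi.sub_apply]
    by_cases hy : y ∈ Icc (-c) c
    · simp only [indicator_of_mem hy]; ring
    · simp only [indicator_of_notMem hy]; ring
  rw [eF]
  refine MemLp.add ?_ (MemLp.add ?_ (MemLp.sub (dt_memLp_archLayer hv hm hHm) (hv.const_mul _)))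
  · -- pole layer: a continuous function cut off to the compact window
    rw [memLp_indicator_iff_restrict measurableSet_Icc]
    have hcont : Continuous fun y : ℝ ↦
        2 * (∫ x, v x * (Real.cosh (x / 2) : ℂ)) * (Real.cosh (y / 2) : ℂ) -
          2 * (∫ x, v x * (Real.sinh (x / 2) : ℂ)) * (Real.sinh (y / 2) : ℂ) := by fun_prop
    obtain ⟨C, hC⟩ := isCompact_Icc.exists_bound_of_continuousOn (hcont.continuousOn (s := Icc (-c) c))
    exact MemLp.of_bound hcont.aestronglyMeasurable.restrict C
      ((ae_restrict_iff' measurableSet_Icc).2 (Eventually.of_forall fun y hy ↦ hC y hy))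
  · -- prime layer: finitely many translates
    refine MemLp.indicator measurableSet_Icc (memLp_finsetSum _ fun n _ ↦ ?_)
    exact (dt_memLp_secondDiff hv _).const_mul _

end Summit.RiemannHypothesis.RiemannHypothesis.Theorems.EvenWinsBeyondArch

end
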